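import Mathlib
import Literature.Computability.AlgebraicComplexity.PartialMatrixMultiplication
import Literature.Computability.AlgebraicComplexity.TensorRestrictionRank

/-!
# Box patterns: `⟨m,m,m⟩` zero-padded into the `n × n` format IS the partial matrix multiplication `⟨n,n,n⟩_{□,□}`

Line `vertex-flattening-factor-rank` for the crux `FidelityWitnesses.DiagonalPowerDecay`
(`stmt-MatrixMultiplication-14053`), lead c2.  Helper file shared by the support landings of the line
(`…ExactnessIJOfOmegaTwo.lean`, `…ProjectorRankDecay.lean`).

For `m ≤ n` let `□ = □_m ⊆ [n] × [n]` be the box of index pairs with both coordinates `< m`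
(written inline as `Finset.univ.filter fun p : Fin n × Fin n => (p.1 : ℕ) < m ∧ (p.2 : ℕ) < m`; no new definition).
The partial matrix multiplication tensor `⟨n,n,n⟩_{□,□}` (`Literature…partialMatMulTensor`, BCS 1997 §15.9) is the
zero-padding of `⟨m,m,m⟩`; we prove the two facts the line needs:

* `tensorRank_partialMatMulTensor_box_le` — `R(⟨n,n,n⟩_{□,□}) ≤ R(⟨m,m,m⟩)`: the padded tensor is a RESTRICTION of
  `⟨m,m,m⟩` (restriction normal form `Σ_{abc} [e a = x][e b = y][e c = z]·⟨m,m,m⟩_{abc}` along the coordinate embedding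
  `e = castLE × castLE`, exactly as in the landed glue `dpdGlue_body_at_emb`; then `TensorRestrictsTo.tensorRank_le`).
* `filling_box` — its filling (number of terms) is `m³`.

Mathlib + Literature (`partialMatMulTensor`, `filling`, `TensorRestrictsTo`) only.
-/

set_option linter.dupNamespace false

namespace Summit.MatrixMultiplication.MatrixMultiplication.Theorems.DiagonalPowerDecay

open scoped BigOperators
open Literature.Computability.AlgebraicComplexity

variable {K : Type*} [CommSemiring K]

/-- Membership in the box pattern `□_m ⊆ [n]×[n]`. [folklore] -/
theorem mem_box_iff {n m : ℕ} (p : Fin n × Fin n) :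
    p ∈ (Finset.univ.filter fun p : Fin n × Fin n => (p.1 : ℕ) < m ∧ (p.2 : ℕ) < m) ↔
      (p.1 : ℕ) < m ∧ (p.2 : ℕ) < m := by
  simp

/-- The coordinate embedding `castLE × castLE : [m]×[m] ↪ [n]×[n]` lands in the box. [folklore] -/
theorem castLE_prod_mem_box {n m : ℕ} (h : m ≤ n) (a : Fin m × Fin m) :
    ((Prod.map (Fin.castLE h) (Fin.castLE h) a).1 : ℕ) < m ∧
      ((Prod.map (Fin.castLE h) (Fin.castLE h) a).2 : ℕ) < m := by
  simp [Prod.map]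

/-- A box point is in the image of the coordinate embedding. [folklore] -/
theorem exists_castLE_prod_eq_of_mem_box {n m : ℕ} (h : m ≤ n) {p : Fin n × Fin n}
    (hp : (p.1 : ℕ) < m ∧ (p.2 : ℕ) < m) :
    ∃ a : Fin m × Fin m, Prod.map (Fin.castLE h) (Fin.castLE h) a = p := by
  refine ⟨(⟨p.1, hp.1⟩, ⟨p.2, hp.2⟩), ?_⟩
  ext <;> simp [Prod.map]

/-- **The box-pattern partial matrix multiplication in restriction normal form**: for `m ≤ n` and
`e = castLE × castLE`,
`⟨n,n,n⟩_{□,□} (x,y,z) = Σ_{a b c} [e a = x]·[e b = y]·[e c = z]·⟨m,m,m⟩_{a b c}`.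
[cite: BurgisserClausenShokrollahi1997, §15.9] -/
theorem partialMatMulTensor_box_eq_sum {n m : ℕ} (h : m ≤ n) (x y z : Fin n × Fin n) :
    partialMatMulTensor K n n n
        (Finset.univ.filter fun p : Fin n × Fin n => (p.1 : ℕ) < m ∧ (p.2 : ℕ) < m)
        (Finset.univ.filter fun p : Fin n × Fin n => (p.1 : ℕ) < m ∧ (p.2 : ℕ) < m) x y z =
      ∑ a : Fin m × Fin m, ∑ b : Fin m × Fin m, ∑ c : Fin m × Fin m,
        (if Prod.map (Fin.castLE h) (Fin.castLE h) a = x then (1 : K) else 0) *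
        (if Prod.map (Fin.castLE h) (Fin.castLE h) b = y then (1 : K) else 0) *
        (if Prod.map (Fin.castLE h) (Fin.castLE h) c = z then (1 : K) else 0) *
          matMulTensor K m m m a b c := by
  classical
  set e : Fin m × Fin m → Fin n × Fin n := Prod.map (Fin.castLE h) (Fin.castLE h) with he
  have hinj : Function.Injective e := (Fin.castLE_injective h).prodMap (Fin.castLE_injective h)
  -- the right-hand side vanishes unless all three indices are in the image of `e`
  have hRHS_off : (¬ ∃ a, e a = x) ∨ (¬ ∃ b, e b = y) ∨ (¬ ∃ c, e c = z) →
      (∑ a : Fin m × Fin m, ∑ b : Fin m × Fin m, ∑ c : Fin m × Fin m,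
        (if e a = x then (1 : K) else 0) * (if e b = y then (1 : K) else 0) *
        (if e c = z then (1 : K) else 0) * matMulTensor K m m m a b c) = 0 := by
    intro hoff
    refine Finset.sum_eq_zero fun a _ => Finset.sum_eq_zero fun b _ =>
      Finset.sum_eq_zero fun c _ => ?_
    rcases hoff with hx | hy | hz
    · have : e a ≠ x := fun hh => hx ⟨a, hh⟩
      simp [this]
    · have : e b ≠ y := fun hh => hy ⟨b, hh⟩
      simp [this]
    · have : e c ≠ z := fun hh => hz ⟨c, hh⟩
      simp [this]
  -- the right-hand side on the image of `e`
  have hRHS_on : ∀ a₀ b₀ c₀ : Fin m × Fin m,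
      (∑ a : Fin m × Fin m, ∑ b : Fin m × Fin m, ∑ c : Fin m × Fin m,
        (if e a = e a₀ then (1 : K) else 0) * (if e b = e b₀ then (1 : K) else 0) *
        (if e c = e c₀ then (1 : K) else 0) * matMulTensor K m m m a b c) =
        matMulTensor K m m m a₀ b₀ c₀ := by
    intro a₀ b₀ c₀
    simp only [hinj.eq_iff]
    rw [Finset.sum_eq_single a₀, Finset.sum_eq_single b₀, Finset.sum_eq_single c₀]
    · simp
    all_goals first
      | (intro i _ hi; simp [hi])
      | simp
  -- case analysis on membership of `x, y, z` in the image
  by_cases hx : ∃ a, e a = x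
  · by_cases hy : ∃ b, e b = y
    · by_cases hz : ∃ c, e c = z
      · obtain ⟨a₀, rfl⟩ := hx
        obtain ⟨b₀, rfl⟩ := hy
        obtain ⟨c₀, rfl⟩ := hz
        rw [hRHS_on]
        -- the left-hand side on the box: the padded `⟨m,m,m⟩`
        have hbm : e b₀ ∈ (Finset.univ.filter fun p : Fin n × Fin n => (p.1 : ℕ) < m ∧ (p.2 : ℕ) < m) :=
          (mem_box_iff _).2 (castLE_prod_mem_box h b₀)
        have hcm : e c₀ ∈ (Finset.univ.filter fun p : Fin n × Fin n => (p.1 : ℕ) < m ∧ (p.2 : ℕ) < m) :=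
          (mem_box_iff _).2 (castLE_prod_mem_box h c₀)
        unfold partialMatMulTensor
        rw [if_pos ⟨hbm, hcm⟩]
        simp [he, matMulTensor, Prod.map, Fin.ext_iff]
      · rw [hRHS_off (Or.inr (Or.inr hz))]
        -- `z` off the box: `z ∉ □`, so the partial tensor vanishes
        unfold partialMatMulTensor
        rw [if_neg]
        rintro ⟨-, hzm⟩
        exact hz (exists_castLE_prod_eq_of_mem_box h ((mem_box_iff _).1 hzm))
    · rw [hRHS_off (Or.inr (Or.inl hy))]
      unfold partialMatMulTensor
      rw [if_neg]
      rintro ⟨hym, -⟩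
      exact hy (exists_castLE_prod_eq_of_mem_box h ((mem_box_iff _).1 hym))
  · rw [hRHS_off (Or.inl hx)]
    -- `x` off the box: if `y, z ∈ □` and the product pattern matches then `x ∈ □`, contradiction
    unfold partialMatMulTensor matMulTensor
    by_cases hyz : y ∈ (Finset.univ.filter fun p : Fin n × Fin n => (p.1 : ℕ) < m ∧ (p.2 : ℕ) < m) ∧
        z ∈ (Finset.univ.filter fun p : Fin n × Fin n => (p.1 : ℕ) < m ∧ (p.2 : ℕ) < m)
    · rw [if_pos hyz, if_neg]
      rintro ⟨h1, -, h3⟩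
      have hym := (mem_box_iff _).1 hyz.1
      have hzm := (mem_box_iff _).1 hyz.2
      refine hx (exists_castLE_prod_eq_of_mem_box h ⟨?_, ?_⟩)
      · rw [h1]; exact hym.1
      · rw [h3]; exact hzm.2
    · rw [if_neg hyz]

/-- **`⟨m,m,m⟩` restricts to the box-pattern partial matrix multiplication `⟨n,n,n⟩_{□,□}`** (`m ≤ n`; zero-padding is
a restriction, Bläser 2013 Def. 7.2 / BCS §14.6). [cite: Blaser2013, Def. 7.2] -/
theorem restrictsTo_partialMatMulTensor_box {n m : ℕ} (h : m ≤ n) :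
    TensorRestrictsTo (matMulTensor K m m m)
      (partialMatMulTensor K n n n
        (Finset.univ.filter fun p : Fin n × Fin n => (p.1 : ℕ) < m ∧ (p.2 : ℕ) < m)
        (Finset.univ.filter fun p : Fin n × Fin n => (p.1 : ℕ) < m ∧ (p.2 : ℕ) < m)) :=
  ⟨fun x a => if Prod.map (Fin.castLE h) (Fin.castLE h) a = x then (1 : K) else 0,
    fun y b => if Prod.map (Fin.castLE h) (Fin.castLE h) b = y then (1 : K) else 0,
    fun z c => if Prod.map (Fin.castLE h) (Fin.castLE h) c = z then (1 : K) else 0,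
    fun x y z => partialMatMulTensor_box_eq_sum h x y z⟩

/-- **Rank of the padded box**: `R(⟨n,n,n⟩_{□_m,□_m}) ≤ R(⟨m,m,m⟩)` for `m ≤ n`
(`TensorRestrictsTo.tensorRank_le`, Bläser 2013 Lemma 5.4). [cite: Blaser2013, Lemma 5.4] -/
theorem tensorRank_partialMatMulTensor_box_le {n m : ℕ} (h : m ≤ n) :
    tensorRank (partialMatMulTensor K n n n
        (Finset.univ.filter fun p : Fin n × Fin n => (p.1 : ℕ) < m ∧ (p.2 : ℕ) < m)
        (Finset.univ.filter fun p : Fin n × Fin n => (p.1 : ℕ) < m ∧ (p.2 : ℕ) < m)) ≤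
      tensorRank (matMulTensor K m m m) :=
  (restrictsTo_partialMatMulTensor_box (K := K) h).tensorRank_le

/-- **Rank of the padded box over `ℂ`** (the instance the line `vertex-flattening-factor-rank` consumes; registered
sub-goal of stmt-MatrixMultiplication-14053): `R(⟨n,n,n⟩_{□_m,□_m}) ≤ R(⟨m,m,m⟩)` for `m ≤ n`. [cite: Blaser2013, Lemma 5.4] -/
theorem tensorRank_partialMatMulTensor_box_le_complex {n m : ℕ} (h : m ≤ n) :
    tensorRank (partialMatMulTensor ℂ n n n
        (Finset.univ.filter fun p : Fin n × Fin n => (p.1 : ℕ) < m ∧ (p.2 : ℕ) < m)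
        (Finset.univ.filter fun p : Fin n × Fin n => (p.1 : ℕ) < m ∧ (p.2 : ℕ) < m)) ≤
      tensorRank (matMulTensor ℂ m m m) :=
  tensorRank_partialMatMulTensor_box_le h

/-- **Filling of the box pattern**: `⟨n,n,n⟩_{□_m,□_m}` computes `m³` scalar products (`m ≤ n`).
[cite: BurgisserClausenShokrollahi1997, Thm. (15.48)] -/
theorem filling_box {n m : ℕ} (h : m ≤ n) :
    filling n n n
        (Finset.univ.filter fun p : Fin n × Fin n => (p.1 : ℕ) < m ∧ (p.2 : ℕ) < m)
        (Finset.univ.filter fun p : Fin n × Fin n => (p.1 : ℕ) < m ∧ (p.2 : ℕ) < m) = m ^ 3 := by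
  classical
  unfold filling
  -- the counted set is the image of `(Fin m)³` under the coordinate embedding
  set e3 : Fin m × Fin m × Fin m → Fin n × Fin n × Fin n :=
    fun q => (Fin.castLE h q.1, Fin.castLE h q.2.1, Fin.castLE h q.2.2) with he3
  have hinj : Function.Injective e3 := by
    intro q q' hq
    simp only [he3, Prod.mk.injEq, (Fin.castLE_injective h).eq_iff] at hq
    ext <;> simp [hq]
  have hset : (Finset.univ.filter fun p : Fin n × Fin n × Fin n =>
      (p.1, p.2.1) ∈ (Finset.univ.filter fun p : Fin n × Fin n => (p.1 : ℕ) < m ∧ (p.2 : ℕ) < m) ∧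
      (p.2.1, p.2.2) ∈ (Finset.univ.filter fun p : Fin n × Fin n => (p.1 : ℕ) < m ∧ (p.2 : ℕ) < m)) =
      Finset.univ.image e3 := by
    ext p
    simp only [Finset.mem_filter, Finset.mem_univ, true_and, Finset.mem_image]
    constructor
    · rintro ⟨⟨h1, h2⟩, -, h3⟩
      refine ⟨(⟨p.1, h1⟩, ⟨p.2.1, h2⟩, ⟨p.2.2, h3⟩), ?_⟩
      ext <;> simp [he3]
    · rintro ⟨q, rfl⟩
      simp [he3]
  rw [hset, Finset.card_image_of_injective _ hinj]
  simp [Finset.card_univ, Fintype.card_prod, Fintype.card_fin]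
  ring

end Summit.MatrixMultiplication.MatrixMultiplication.Theorems.DiagonalPowerDecay
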